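import Literature.MathematicalPhysics.QuantumLattice.HubbardSliceSymbolSmoothXiThird
import HarnessLib

/-!
# Increments of the slice symbol in the band variable: `‖Ψ̂⁽ⁱ⁾(ξ + w) − Ψ̂⁽ⁱ⁾(ξ)‖ ≲ |w|·βL²/Λ^{i+2}`, `i = 0, 1, 2`

Topic `MathematicalPhysics/QuantumLattice`; continues `HubbardSliceSymbolSmoothMomentum` / `HubbardSliceSymbolSmoothXiThird` (the single-scale
symbol `Ψ̂_ω(ξ) = W(ξ)·R(ξ)` of the shifted Salmhofer slice `C^θ_{(Λ,Λ′]}` as a `C³` function of the band variable `ξ`, with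
`‖Ψ̂′‖ ≤ (16B₁+16)c/Λ²`, `‖Ψ̂″‖ ≤ (32B₂+144B₁+128)c/Λ³`, `‖Ψ̂‴‖ ≤ (64B₃+480B₂+1728B₁+1536)c/Λ⁴`).  At a FRAMED band `ξ = e_K = ε − μ − Σₘ Kₘ`
the symbol is telescoped over the frame pieces (Benfatto–Giuliani–Mastropietro 2006, §3 (3.2)–(3.8): `Ψ̂(e_{<m} − Kₘ) − Ψ̂(e_{<m})`, each
increment small at its own scale); the `m`-th increment and its band derivatives are controlled by the mean value inequality in `ξ`.
This file is that inequality for `Ψ̂`, `Ψ̂′`, `Ψ̂″` (slice twin of the band-increment interpolation of `HubbardUVSymbolBandIncrements`):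

* `norm_sliceSymbolFnXi_sub_le` — `‖Ψ̂(ξ + w) − Ψ̂(ξ)‖ ≤ (16B₁ + 16)·c/Λ² · |w|`;
* `norm_sliceSymbolFnXiD1_sub_le` — `‖Ψ̂′(ξ + w) − Ψ̂′(ξ)‖ ≤ (32B₂ + 144B₁ + 128)·c/Λ³ · |w|`;
* `norm_sliceSymbolFnXiD2_sub_le` — `‖Ψ̂″(ξ + w) − Ψ̂″(ξ)‖ ≤ (64B₃ + 480B₂ + 1728B₁ + 1536)·c/Λ⁴ · |w|`

(`c ≥ 0`, `0 < Λ ≤ Λ′`, `|θ| ≤ Λ/4`; `B₁, B₂, B₃` global bounds of `χ₂′, χ₂″, χ₂‴`).  Everything is proved; no definitions; no named facts.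

## Sources

G. Benfatto, A. Giuliani, V. Mastropietro, Ann. Henri Poincaré 7 (2006) 809–898, (2.36aa), (2.50), §3 (3.2)–(3.8) (`BenfattoGiulianiMastropietro2006`);
M. Salmhofer, *Renormalization* (1999), §4.2.5 (4.70)–(4.71) (`Salmhofer1999`).
-/

noncomputable section

namespace Literature.MathematicalPhysics.QuantumLattice

open Literature.Probability.LatticeModels Set Complex

section XiIncr

variable {c θ Λ Λ' ω : ℝ}

/-- Mean value inequality on the real line for a function with a derivative everywhere bounded by `C`:
`‖f(ξ + w) − f(ξ)‖ ≤ C·|w|`. [cite: BenfattoGiulianiMastropietro2006, §3 (3.2)] -/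
theorem norm_sub_le_of_hasDerivAt_bound {f f' : ℝ → ℂ} {C : ℝ} (hf : ∀ x, HasDerivAt f (f' x) x) (hC : ∀ x, ‖f' x‖ ≤ C)
    (ξ w : ℝ) : ‖f (ξ + w) - f ξ‖ ≤ C * |w| := by
  have h := Convex.norm_image_sub_le_of_norm_hasDerivWithin_le (𝕜 := ℝ) (s := Set.univ)
    (fun x _ => (hf x).hasDerivWithinAt) (fun x _ => hC x) convex_univ (Set.mem_univ ξ) (Set.mem_univ (ξ + w))
  simpa [Real.norm_eq_abs] using h

/-- **`‖Ψ̂(ξ + w) − Ψ̂(ξ)‖ ≤ (16B₁ + 16)·c/Λ² · |w|`** — the zeroth-order band increment of the slice symbol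
(`c ≥ 0`, `0 < Λ ≤ Λ′`, `|θ| ≤ Λ/4`). [cite: BenfattoGiulianiMastropietro2006, (2.36aa)] -/
theorem norm_sliceSymbolFnXi_sub_le (hΛ : 0 < Λ) (hΛΛ' : Λ ≤ Λ') (hθ : |θ| ≤ Λ / 4) (hc : 0 ≤ c) {B₁ : ℝ}
    (hB₁ : ∀ x, |deriv salmhoferCutoff x| ≤ B₁) (ξ w : ℝ) :
    ‖sliceSymbolFnXi c θ Λ Λ' ω (ξ + w) - sliceSymbolFnXi c θ Λ Λ' ω ξ‖ ≤ (16 * B₁ + 16) * c / Λ ^ 2 * |w| :=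
  norm_sub_le_of_hasDerivAt_bound (fun x => hasDerivAt_sliceSymbolFnXi hΛ hΛΛ' hθ x)
    (fun x => norm_sliceSymbolFnXiD1_le hΛ hΛΛ' hθ hc hB₁ x) ξ w

/-- **`‖Ψ̂′(ξ + w) − Ψ̂′(ξ)‖ ≤ (32B₂ + 144B₁ + 128)·c/Λ³ · |w|`** — the band increment of the first `ξ`-derivative.
[cite: BenfattoGiulianiMastropietro2006, (2.36aa)] -/
theorem norm_sliceSymbolFnXiD1_sub_le (hΛ : 0 < Λ) (hΛΛ' : Λ ≤ Λ') (hθ : |θ| ≤ Λ / 4) (hc : 0 ≤ c) {B₁ B₂ : ℝ}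
    (hB₁ : ∀ x, |deriv salmhoferCutoff x| ≤ B₁) (hB₂ : ∀ x, |deriv (deriv salmhoferCutoff) x| ≤ B₂) (ξ w : ℝ) :
    ‖sliceSymbolFnXiD1 c θ Λ Λ' ω (ξ + w) - sliceSymbolFnXiD1 c θ Λ Λ' ω ξ‖ ≤ (32 * B₂ + 144 * B₁ + 128) * c / Λ ^ 3 * |w| :=
  norm_sub_le_of_hasDerivAt_bound (fun x => hasDerivAt_sliceSymbolFnXiD1 hΛ hΛΛ' hθ x)
    (fun x => norm_sliceSymbolFnXiD2_le hΛ hΛΛ' hθ hc hB₁ hB₂ x) ξ w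

/-- **`‖Ψ̂″(ξ + w) − Ψ̂″(ξ)‖ ≤ (64B₃ + 480B₂ + 1728B₁ + 1536)·c/Λ⁴ · |w|`** — the band increment of the second `ξ`-derivative.
[cite: BenfattoGiulianiMastropietro2006, (2.36aa)] -/
theorem norm_sliceSymbolFnXiD2_sub_le (hΛ : 0 < Λ) (hΛΛ' : Λ ≤ Λ') (hθ : |θ| ≤ Λ / 4) (hc : 0 ≤ c) {B₁ B₂ B₃ : ℝ}
    (hB₁ : ∀ x, |deriv salmhoferCutoff x| ≤ B₁) (hB₂ : ∀ x, |deriv (deriv salmhoferCutoff) x| ≤ B₂)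
    (hB₃ : ∀ x, |deriv (deriv (deriv salmhoferCutoff)) x| ≤ B₃) (ξ w : ℝ) :
    ‖sliceSymbolFnXiD2 c θ Λ Λ' ω (ξ + w) - sliceSymbolFnXiD2 c θ Λ Λ' ω ξ‖ ≤
      (64 * B₃ + 480 * B₂ + 1728 * B₁ + 1536) * c / Λ ^ 4 * |w| :=
  norm_sub_le_of_hasDerivAt_bound (fun x => hasDerivAt_sliceSymbolFnXiD2 hΛ hΛΛ' hθ x)
    (fun x => norm_sliceSymbolFnXiD3_le hΛ hΛΛ' hθ hc hB₁ hB₂ hB₃ x) ξ w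

end XiIncr

end Literature.MathematicalPhysics.QuantumLattice

end
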